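import Summits.HodgeConjecture.CorCM.CMSliceExhaustion
import Literature.NumberTheory.ComplexMultiplication.NonPrimitiveCMTypeInduced
import Literature.AlgebraicGeometry.ComplexMultiplication.PrimitiveCMTypeSimple
import Literature.NumberTheory.ComplexMultiplication.ShimuraTaniyamaHecke
import Literature.AlgebraicGeometry.Milne1999.CMTypeSimpleIsogenyFactors
import Literature.AlgebraicGeometry.Motives.AbelianVarietySimpleFactorsUnique
import Literature.AlgebraicGeometry.Motives.AbelianVarietyKernelComponent
import HarnessLib

/-!
# Simple isogeny factors of `∏_j A_{(F,Θ_j)}` have `End⁰ →+* F` — the binder-language slices of `HC_CM` ARE its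
# `F`-components

COR-CM (cell `pub-hodgecm2`), seat b24, count-neutral lane SLICE-EXHAUSTION, part 2 (theorems only, no definition, no
named fact).  The per-field slice theorems of the cell are stated in the binder language of `HC_CM = CMAbelianHodge`:
«for every complex abelian variety `A` of CM type whose simple abelian subvarieties `B ↪ A` of positive dimension have
`End⁰(B) →+* F`, `HodgeConjectureFor A.dim A.X`» (`cmAbelianHodge_slice_quartic`, `…_sextic_of_markman`,
`CyclotomicSlice…Binders`).  Part 1 (`CMSliceExhaustion`) showed `HC_CM ⟺ ∀ F` (Galois CM, degree `≥ 6`) `∀ n Θ`,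
`HodgeConjectureFor (cmProdAV F h₃ n Θ)`.  Here the two slice languages are identified, by the one missing fact:

* §1 `exists_primitive_core` — every CM type `Θ` of a number field `M` is induced from a PRIMITIVE CM type `Ψ` of a
  subfield `k : K →+* M` (Shimura §8.2 Prop. 26 iterated: tree `exists_inducedCMType_of_not_primitive`, strong induction on
  the degree); `isCMField_of_ringHom_of_cmType` — such a `K` inside a CM field is CM.
* §2 `nonempty_ringHom_endAlgebra_of_isCMTypeRealisation_of_isSimple` — for a SIMPLE realisation `(C, ι)` of a CM type of
  `K`, `End⁰(C) →+* K` (indeed `≅`: `ι` extends to `K →+* End⁰(C)` (`exists_ringHom_endAlgebra`, Serre–Tate §4), injective,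
  and `dim_ℚ End⁰(C) = 2 dim C = [K:ℚ]` by Shimura §5.1 Props. 3–6 = tree `IsOfCMType.isOfCMTypeSimple`).
* §3 **`nonempty_ringHom_endAlgebra_of_hom_ne_zero`** — a SIMPLE `B` with a non-zero homomorphism `B ⟶ A_{(F,Θ)}` has
  `End⁰(B) →+* F`: write `Θ = Ψ^F` with `Ψ` primitive on `K ⊂ F` (§1); Shimura §6.2 Thm. 3 (tree theorem
  `shimura1998_Thm3_isogenousPower_and_Thm2_cor`) makes `A_{(F,Θ)}` isogenous to a power `C^h` of a realisation `C` of `Ψ`,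
  simple by §8.2 Prop. 26 (`isSimple_of_isCMTypeRealisation_of_primitive`); some coordinate `B ⟶ C` is non-zero, hence an
  isogeny (Mumford §19 Cor. 2, `hsimple_of_isAlgClosed`), so `End⁰(B) ↪ End⁰(C) ≅ K ⊂ F`.
  **`…_of_avDominatedBy_cmProdAV`** (isogeny factors of `∏_j A_{(F,Θ_j)}`), **`…_of_isClosedImmersion_cmProdAV`** (simple
  abelian subvarieties, via Poincaré `isSimpleIsogenyFactor_of_isClosedImmersion`).
* §4 **`binderSlice_iff_forall_cmProdAV`** — for every CM field `F`: the binder-language slice at `F` ⟺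
  `∀ n Θ, HodgeConjectureFor (cmProdAV F cmAbelianVarietyRealised_holds n Θ)`;
  **`hc_cm_iff_forall_galois_binderSlice`** — `HC_CM ⟺` the binder-language slices at the Galois CM fields of degree `≥ 6`;
  `hc_cm_iff_forall_binderSlice` (all CM fields).  Neither side is asserted anywhere.

## References
* [Shimura1998] G. Shimura, *Abelian Varieties with Complex Multiplication and Modular Functions* (1998), §5.1 Props. 3–6,
  §6.2 Theorem 3 (pp. 41–43), §8.2 Proposition 26 (pp. 61–63), §18.2 Lemma (iv).
* [MumfordAV1970] D. Mumford, *Abelian Varieties* (1970), §19 Thm. 1, Cor. 1–2, Remark p. 169.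
* [SerreTate1968] J.-P. Serre, J. Tate, *Good reduction of abelian varieties*, §4 (the datum `i : F → ℚ ⊗ End A`).
* [Milne1999] J. S. Milne, Compositio Math. 117 (1999), §2 p. 54.
* [Streng2010] M. Streng, thesis (2010), Ch. I Def. 3.2, Lemma 3.5.
-/

noncomputable section

open CategoryTheory CategoryTheory.Limits NumberField AlgebraicGeometry
open Literature.AlgebraicGeometry Literature.AlgebraicGeometry.Motives Literature.AlgebraicGeometry.HodgeTheory
open Literature.AlgebraicGeometry.ComplexMultiplication Literature.AlgebraicGeometry.Milne1999
open Literature.NumberTheory.ComplexMultiplication (inducedCMType inducedCMType_id inducedCMType_comp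
  isOfCMType_of_isCMTypeRealisation exists_inducedCMType_of_not_primitive')
open Literature.NumberTheory.Automorphic.PicardCM (cmRealisation CMAbelianVarietyRealised)
open Summit.HodgeConjecture.CorCM.Domination

namespace Summit.HodgeConjecture.CorCM.SliceExhaustion

/-! ## §1 The primitive core of a CM type -/

/-- **Every CM type is induced from a primitive one** (strong induction on the degree: a CM type that is not primitive —
two distinct embeddings with the same `Aut(ℂ)`-pattern — is induced from a CM type of a PROPER subfield, Shimura §8.2
Prop. 26 = tree `exists_inducedCMType_of_not_primitive'`; inducing is transitive, `inducedCMType_comp`).  Primitivity is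
stated in the tree's `Aut(ℂ)`-pattern form (Streng Def. 3.2; `isPrimitive_ringEquiv_complex_iff`).
[cite: Shimura1998, §8.2 Proposition 26 (pp. 61–63)] [cite: Streng2010, Ch. I Def. 3.2 and Lemma 3.5] -/
theorem exists_primitive_core_of_finrank_le :
    ∀ (d : ℕ) (M : Type) [Field M] [NumberField M] (Φ : CMType M), Module.finrank ℚ M ≤ d →
      ∃ (K : Type) (_ : Field K) (_ : NumberField K) (k : K →+* M) (Φ₀ : CMType K),
        inducedCMType k Φ₀ = Φ ∧
          ∀ s t : K →+* ℂ,
            (∀ τ : ℂ ≃+* ℂ, (τ : ℂ →+* ℂ).comp s ∈ Φ₀.1 ↔ (τ : ℂ →+* ℂ).comp t ∈ Φ₀.1) → s = t := by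
  intro d
  induction d with
  | zero =>
      intro M _ _ Φ hd
      exact absurd hd (not_le.2 Module.finrank_pos)
  | succ d ih =>
      intro M _ _ Φ hd
      by_cases hprim : ∀ s t : M →+* ℂ,
          (∀ τ : ℂ ≃+* ℂ, (τ : ℂ →+* ℂ).comp s ∈ Φ.1 ↔ (τ : ℂ →+* ℂ).comp t ∈ Φ.1) → s = t
      · exact ⟨M, inferInstance, inferInstance, RingHom.id M, Φ, inducedCMType_id Φ, hprim⟩
      · push Not at hprim
        obtain ⟨s, t, hpat, hst⟩ := hprim
        obtain ⟨K, Φ₀, hK, hΦ⟩ := exists_inducedCMType_of_not_primitive' Φ hst hpat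
        haveI : NumberField K := @NumberField.mk K _ inferInstance inferInstance
        have hinj : Function.Injective ((algebraMap K M).toRatAlgHom.toLinearMap) := (algebraMap K M).injective
        have hle : Module.finrank ℚ K ≤ Module.finrank ℚ M := LinearMap.finrank_le_finrank_of_injective hinj
        have hne : Module.finrank ℚ K ≠ Module.finrank ℚ M := fun heq =>
          hK ((LinearMap.injective_iff_surjective_of_finrank_eq_finrank heq).1 hinj)
        obtain ⟨K', _, _, k', Ψ, hΨ, hprim'⟩ := ih K Φ₀ (by omega)
        refine ⟨K', inferInstance, inferInstance, (algebraMap K M).comp k', Ψ, ?_, hprim'⟩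
        rw [inducedCMType_comp, hΨ, hΦ]

/-- **The primitive core of a CM type**: for every CM type `Φ` of a number field `M` there are a number field `K`, a
ring homomorphism `k : K →+* M` and a PRIMITIVE CM type `Φ₀` of `K` with `Φ = Φ₀^M` (`inducedCMType k Φ₀ = Φ`).
[cite: Shimura1998, §8.2 Proposition 26 (pp. 61–63)] [cite: Streng2010, Ch. I Def. 3.2 and Lemma 3.5] -/
theorem exists_primitive_core (M : Type) [Field M] [NumberField M] (Φ : CMType M) :
    ∃ (K : Type) (_ : Field K) (_ : NumberField K) (k : K →+* M) (Φ₀ : CMType K),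
      inducedCMType k Φ₀ = Φ ∧
        ∀ s t : K →+* ℂ,
          (∀ τ : ℂ ≃+* ℂ, (τ : ℂ →+* ℂ).comp s ∈ Φ₀.1 ↔ (τ : ℂ →+* ℂ).comp t ∈ Φ₀.1) → s = t :=
  exists_primitive_core_of_finrank_le _ M Φ le_rfl

/-- **A number field carrying a CM type and embedding into a CM field is a CM field** (it is totally real or CM by
Shimura §18.2 Lemma (iv) = tree `isCMField_of_ringHom_of_not_isReal`, and totally complex because it carries a CM type,
`CMTypeLattice.isTotallyComplex_of_cmType`). [cite: Shimura1998, §18.2 Lemma (iv)] -/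
theorem isCMField_of_ringHom_of_cmType {K F : Type} [Field K] [NumberField K] [Field F] [NumberField F] [IsCMField F]
    (k : K →+* F) (Ψ : CMType K) : IsCMField K := by
  haveI := Literature.NumberTheory.ComplexMultiplication.CMTypeLattice.isTotallyComplex_of_cmType Ψ
  obtain ⟨ψ⟩ : Nonempty (K →+* ℂ) := inferInstance
  exact Literature.NumberTheory.NumberFields.isCMField_of_ringHom_of_not_isReal k (Or.inr inferInstance)
    (IsTotallyComplex.complexEmbedding_not_isReal ψ)

/-! ## §2 `End⁰` of a simple realisation of `(K; Ψ)` is `K` -/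

/-- **For a SIMPLE realisation `(C, ι, θ)` of a CM type `Ψ` of `K`, `End⁰(C) →+* K`** (indeed `End⁰(C) ≅ K`):
`ι : 𝓞_K → End C` extends to `i : K →+* End⁰(C)` (Serre–Tate's datum, tree `exists_ringHom_endAlgebra`), `i` is injective
(`K` is a field), and `dim_ℚ End⁰(C) = 2 dim C` for a simple abelian variety of CM type (Shimura §5.1 Props. 3–6 = tree
`IsOfCMType.isOfCMTypeSimple`) while `2 dim C = [K:ℚ]` (`C` is smooth projective of dimension `[K:ℚ]/2`, `K` totally
complex); so `i` is bijective and its inverse is the required homomorphism.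
[cite: Shimura1998, §5.1 Propositions 3–6] [cite: SerreTate1968, §4] [cite: MumfordAV1970, §19 Cor. 2 of Thm. 1 (p. 174)] -/
theorem nonempty_ringHom_endAlgebra_of_isCMTypeRealisation_of_isSimple {K : Type} [Field K] [NumberField K]
    {Ψ : CMType K} {C : AbelianVariety ℂ} {ι : 𝓞 K →+* End C} {θ : K →+* Module.End ℂ (complexBetti C.X 1)}
    (hC : IsCMTypeRealisation Ψ C ι θ) (hCs : AbelianVariety.IsSimple C) : Nonempty (C.endAlgebra →+* K) := by
  obtain ⟨i, -⟩ := Literature.NumberTheory.ComplexMultiplication.exists_ringHom_endAlgebra (A₀ := C) ι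
  haveI := Literature.NumberTheory.ComplexMultiplication.CMTypeLattice.isTotallyComplex_of_cmType Ψ
  have hdim : C.dim = Module.finrank ℚ K / 2 := Motives.schemeDim_eq_holds hC.1
  have hK2 : Module.finrank ℚ K = 2 * InfinitePlace.nrComplexPlaces K := by
    rw [← InfinitePlace.card_add_two_mul_card_eq_rank, IsTotallyComplex.nrRealPlaces_eq_zero, zero_add]
  have hKpos : 0 < Module.finrank ℚ K := Module.finrank_pos
  have hC0 : 0 < C.dim := by omega
  obtain ⟨hF, hfin⟩ := (isOfCMType_of_isCMTypeRealisation hC).isOfCMTypeSimple hCs hC0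
  -- work in the number field `EndField C hF` (= `End⁰(C)` with its field structure)
  let i' : K →+* EndField C hF := (EndField.toEndAlgebra hF).symm.toRingHom.comp i
  have heq : Module.finrank ℚ K = Module.finrank ℚ (EndField C hF) := by
    rw [EndField.finrank_eq, hfin]; omega
  have hinj : Function.Injective i'.toRatAlgHom.toLinearMap := i'.injective
  -- (the `AddCommGroup`/`Module ℚ` instances of the type synonym `EndField` are passed explicitly: the two
  -- instance paths to `AddCommMonoid` agree only at default transparency)
  have hsurj : Function.Surjective i' :=
    (@LinearMap.injective_iff_surjective_of_finrank_eq_finrank ℚ K _ _ _ (EndField C hF)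
      (EndField.instField hF).toDivisionRing.toRing.toAddCommGroup Algebra.toModule _ _ heq
      i'.toRatAlgHom.toLinearMap).1 hinj
  exact ⟨(RingEquiv.ofBijective i' ⟨i'.injective, hsurj⟩).symm.toRingHom.comp
    (EndField.toEndAlgebra hF).symm.toRingHom⟩

/-! ## §3 Simple abelian varieties mapping non-trivially to `A_{(F,Θ)}`, to `∏_j A_{(F,Θ_j)}` -/

variable {F : Type} [Field F] [NumberField F] [IsCMField F]

/-- **A simple `B` with a non-zero homomorphism `B ⟶ A_{(F,Θ)}` has `End⁰(B) →+* F`.**  Write `Θ = Ψ^F` with `Ψ` a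
primitive CM type of `K`, `k : K →+* F` (§1; `K` is CM).  The chosen realisation `A_{(F,Θ)}` realises `Ψ^F` on `H¹`
(`isCMTypeRealisation_cmCode`), so Shimura's Theorem 3 (tree theorem `shimura1998_Thm3_isogenousPower_and_Thm2_cor`) gives a
realisation `C` of `Ψ`, a product fan `P ≅ C^h` and an isogeny `g : A_{(F,Θ)} ⟶ P`; `C` is simple (§8.2 Prop. 26,
`isSimple_of_isCMTypeRealisation_of_primitive`).  `φ ≫ g ≠ 0` (an isogeny has a quasi-inverse and `Hom` is torsion-free),
so some coordinate `φ ≫ g ≫ π_i : B ⟶ C` is non-zero, hence an isogeny between simple abelian varieties (Mumford §19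
Cor. 2, `hsimple_of_isAlgClosed`), and `End⁰(B) ↪ End⁰(C) →+* K →+* F` (`IsIsogeny.exists_algHom_injective`, §2).
[cite: Shimura1998, §6.2 Theorem 3 (pp. 41–43) and §8.2 Proposition 26] [cite: MumfordAV1970, §19 Cor. 2 of Thm. 1 and Remark p. 169] -/
theorem nonempty_ringHom_endAlgebra_of_hom_ne_zero (h₃ : CMAbelianVarietyRealised) (Θ : CMType F)
    {B : AbelianVariety ℂ} (hB : AbelianVariety.IsSimple B) (φ : B ⟶ (cmRealisation h₃ (cmCode F Θ)).AV)
    (hφ : φ ≠ 0) : Nonempty (B.endAlgebra →+* F) := by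
  obtain ⟨K, _, _, k, Ψ, hΘ, hprim⟩ := exists_primitive_core F Θ
  subst hΘ
  haveI : IsCMField K := isCMField_of_ringHom_of_cmType k Ψ
  have hA := isCMTypeRealisation_cmCode F h₃ (inducedCMType k Ψ)
  obtain ⟨C, ιC, θC, hC, h, P, π, ⟨hlim⟩, g, hg, -⟩ :=
    shimura1998_Thm3_isogenousPower_and_Thm2_cor.1 K F k Ψ _ _ _ hA
  have hCs : C.IsSimple := isSimple_of_isCMTypeRealisation_of_primitive hC hprim
  -- `φ ≫ g ≠ 0`
  obtain ⟨g', N, hN, hgg', -⟩ := AbelianVariety.IsIsogeny.exists_nsmul_inverse_holds hg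
  have hφg : φ ≫ g ≠ 0 := by
    intro h0
    refine hφ (AbelianVariety.hom_eq_zero_of_nsmul_eq_zero hN.ne' ?_)
    calc N • φ = φ ≫ (N • 𝟙 _) := by rw [Preadditive.comp_nsmul, Category.comp_id]
      _ = (φ ≫ g) ≫ g' := by rw [← hgg', Category.assoc]
      _ = 0 := by rw [h0, zero_comp]
  -- some coordinate `B ⟶ C` is non-zero
  have hex : ∃ i, (φ ≫ g) ≫ π i ≠ 0 := by
    by_contra hall
    push Not at hall
    refine hφg (Fan.IsLimit.hom_ext hlim _ _ fun i => ?_)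
    change (φ ≫ g) ≫ π i = 0 ≫ π i
    rw [hall i, zero_comp]
  obtain ⟨i, hi⟩ := hex
  have hiso : AbelianVariety.IsIsogeny ((φ ≫ g) ≫ π i) :=
    AbelianVariety.hsimple_of_isAlgClosed ℂ B C hB hCs _ hi
  obtain ⟨⟨η, -⟩, -⟩ := AbelianVariety.IsIsogeny.exists_algHom_injective hiso
  obtain ⟨e⟩ := nonempty_ringHom_endAlgebra_of_isCMTypeRealisation_of_isSimple hC hCs
  exact ⟨k.comp (e.comp η.toRingHom)⟩

/-- **Simple isogeny factors of `∏_j A_{(F,Θ_j)}` have `End⁰ →+* F`**: if `B` is simple of positive dimension and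
`s ≫ p = [N]_B` (`N ≠ 0`) through `cmProdAV F h₃ n Θ`, then `s ≠ 0` (`Hom` is torsion-free, `𝟙_B ≠ 0`), so some
coordinate `B ⟶ A_{(F,Θ_j)}` of `s` in the biproduct `⨁_j A_{(F,Θ_j)} ≅ cmProdAV` is non-zero.
[cite: MumfordAV1970, §19 Thm. 1, Cor. 1–2 (pp. 173–174)] [cite: Shimura1998, §6.2 Theorem 3 and §8.2 Proposition 26] -/
theorem nonempty_ringHom_endAlgebra_of_avDominatedBy_cmProdAV (h₃ : CMAbelianVarietyRealised) {n : ℕ}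
    {Θ : Fin (n + 1) → CMType F} {B : AbelianVariety ℂ} (hB : AbelianVariety.IsSimple B) (hB0 : 0 < B.dim)
    (h : AVDominatedBy B (cmProdAV F h₃ n Θ)) : Nonempty (B.endAlgebra →+* F) := by
  classical
  obtain ⟨s, p, N, hN, hsp⟩ := h.biproduct_of_cmProdAV
  have hs : s ≠ 0 := by
    intro h0
    refine AbelianVariety.id_ne_zero_of_dim_pos hB0 (AbelianVariety.hom_eq_zero_of_nsmul_eq_zero hN ?_)
    rw [← hsp, h0, zero_comp]
  have hex : ∃ j, s ≫ biproduct.π (fun j => (cmRealisation h₃ (cmCode F (Θ j))).AV) j ≠ 0 := by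
    by_contra hall
    push Not at hall
    exact hs (biproduct.hom_ext _ _ fun j => by rw [hall j, zero_comp])
  obtain ⟨j, hj⟩ := hex
  exact nonempty_ringHom_endAlgebra_of_hom_ne_zero h₃ (Θ j) hB _ hj

/-- A factor of a binary product is dominated by it: `B ≼ B × C`. [cite: MumfordAV1970, §19] -/
theorem avDominatedBy_prod_left (B C : AbelianVariety ℂ) : AVDominatedBy B (B.prod C) :=
  ⟨biprod.inl ≫ (AbelianVariety.biprodIsoProd B C).hom, (AbelianVariety.biprodIsoProd B C).inv ≫ biprod.fst, 1,
    one_ne_zero, by rw [Category.assoc, (AbelianVariety.biprodIsoProd B C).hom_inv_id_assoc, biprod.inl_fst, one_smul]⟩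

/-- **Simple abelian SUBVARIETIES of `∏_j A_{(F,Θ_j)}` have `End⁰ →+* F`** — the side condition of the binder-language
slices, discharged on the products themselves: a simple abelian subvariety of positive dimension is a simple isogeny
factor (Poincaré's complete reducibility, tree `isSimpleIsogenyFactor_of_isClosedImmersion`), and the previous theorem.
[cite: MumfordAV1970, §19 Thm. 1 (pp. 173–174)] [cite: Shimura1998, §6.2 Theorem 3 and §8.2 Proposition 26] -/
theorem nonempty_ringHom_endAlgebra_of_isClosedImmersion_cmProdAV (h₃ : CMAbelianVarietyRealised) {n : ℕ}
    {Θ : Fin (n + 1) → CMType F} {B : AbelianVariety ℂ} (f : B ⟶ cmProdAV F h₃ n Θ)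
    (hf : IsClosedImmersion (AbelianVariety.Hom.toSchemeHom f)) (hB : AbelianVariety.IsSimple B) (hB0 : 0 < B.dim) :
    Nonempty (B.endAlgebra →+* F) := by
  haveI := hf
  obtain ⟨-, -, C, g, hg⟩ := isSimpleIsogenyFactor_of_isClosedImmersion f hB hB0
  exact nonempty_ringHom_endAlgebra_of_avDominatedBy_cmProdAV h₃ hB hB0 ((avDominatedBy_prod_left B C).trans_isIsogeny_inv hg)

/-! ## §4 The binder-language slice at `F` is the `cmProdAV` slice at `F`; `HC_CM` ⟺ its binder-language slices -/

/-- **The `cmProdAV` slice at `F` gives the binder-language slice at `F`**: HC for every complex abelian variety of CM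
type whose simple abelian subvarieties of positive dimension have `End⁰ →+* F` (dimension `0`: the tree's HC in dimension
`≤ 3`; positive dimension: seat b30's record-free domination `exists_avDominatedBy_cmProdAV_of_isOfCMType_of_endAlgebra`
and `hodgeConjectureFor_of_avDominatedBy`). [cite: Shimura1998, §5.1, §6.2 Theorem 3, §7.1 Proposition 7]
[cite: MumfordAV1970, §19 Thm. 1] [cite: Milne1999, §2 p. 54] -/
theorem hodgeConjectureFor_of_isOfCMType_of_endAlgebra_of_forall_cmProdAV
    (h : ∀ (n : ℕ) (Θ : Fin (n + 1) → CMType F),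
      HodgeConjectureFor (cmProdAV F cmAbelianVarietyRealised_holds n Θ).dim (cmProdAV F cmAbelianVarietyRealised_holds n Θ).X)
    {A : AbelianVariety ℂ} (hCM : IsOfCMType A)
    (hend : ∀ (B : AbelianVariety ℂ) (f : B ⟶ A), IsClosedImmersion (AbelianVariety.Hom.toSchemeHom f) →
      AbelianVariety.IsSimple B → 0 < B.dim → Nonempty (B.endAlgebra →+* F)) :
    HodgeConjectureFor A.dim A.X := by
  rcases Nat.eq_zero_or_pos A.dim with hA0 | hA0
  · exact hodgeConjectureFor_of_dim_le_three_holds (by omega) (AbelianVariety.isSmoothProjective_holds (A := A))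
  · obtain ⟨n, Θ, hdom⟩ := CyclicSextic.exists_avDominatedBy_cmProdAV_of_isOfCMType_of_endAlgebra hA0 hCM hend
    exact hodgeConjectureFor_of_avDominatedBy (h n Θ) hdom

/-- **The binder-language slice at `F` gives the `cmProdAV` slice at `F`** (at the tree's realisation record
`cmAbelianVarietyRealised_holds`): `∏_j A_{(F,Θ_j)}` is smooth projective, of CM type (`isOfCMType_cmProdAV`), and its simple
abelian subvarieties have `End⁰ →+* F` (`nonempty_ringHom_endAlgebra_of_isClosedImmersion_cmProdAV`).
[cite: Shimura1998, §6.2 Theorem 3 and §8.2 Proposition 26] [cite: Milne1999, §2 p. 54] -/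
theorem forall_cmProdAV_of_binderSlice (h₃ : CMAbelianVarietyRealised)
    (h : ∀ A : AbelianVariety ℂ, IsSmoothProjective A.dim A.X →
      (∃ S : Subalgebra ℚ A.endAlgebra,
        IsReduced ↥S ∧ (∀ x ∈ S, ∀ y ∈ S, x * y = y * x) ∧ Module.finrank ℚ ↥S = 2 * A.dim) →
      (∀ (B : AbelianVariety ℂ) (f : B ⟶ A), IsClosedImmersion (AbelianVariety.Hom.toSchemeHom f) →
        AbelianVariety.IsSimple B → 0 < B.dim → Nonempty (B.endAlgebra →+* F)) →
      HodgeConjectureFor A.dim A.X)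
    (n : ℕ) (Θ : Fin (n + 1) → CMType F) : HodgeConjectureFor (cmProdAV F h₃ n Θ).dim (cmProdAV F h₃ n Θ).X :=
  h _ AbelianVariety.isSmoothProjective_holds (isOfCMType_cmProdAV h₃ n Θ) fun _ f hf hB hB0 =>
    nonempty_ringHom_endAlgebra_of_isClosedImmersion_cmProdAV h₃ f hf hB hB0

/-- **The two slice languages agree at every CM field `F`**: the binder-language slice (`CMAbelianHodge` binders
VERBATIM plus «simple abelian subvarieties have `End⁰ →+* F`») ⟺ HC for all `∏_j A_{(F,Θ_j)}` over the tree's realisation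
record. [cite: Shimura1998, §6.2 Theorem 3 and §8.2 Proposition 26] [cite: Milne1999, §2 p. 54] -/
theorem binderSlice_iff_forall_cmProdAV :
    (∀ A : AbelianVariety ℂ, IsSmoothProjective A.dim A.X →
      (∃ S : Subalgebra ℚ A.endAlgebra,
        IsReduced ↥S ∧ (∀ x ∈ S, ∀ y ∈ S, x * y = y * x) ∧ Module.finrank ℚ ↥S = 2 * A.dim) →
      (∀ (B : AbelianVariety ℂ) (f : B ⟶ A), IsClosedImmersion (AbelianVariety.Hom.toSchemeHom f) →
        AbelianVariety.IsSimple B → 0 < B.dim → Nonempty (B.endAlgebra →+* F)) →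
      HodgeConjectureFor A.dim A.X) ↔
    ∀ (n : ℕ) (Θ : Fin (n + 1) → CMType F),
      HodgeConjectureFor (cmProdAV F cmAbelianVarietyRealised_holds n Θ).dim
        (cmProdAV F cmAbelianVarietyRealised_holds n Θ).X :=
  ⟨forall_cmProdAV_of_binderSlice cmAbelianVarietyRealised_holds,
    fun h _ _ hCM hend => hodgeConjectureFor_of_isOfCMType_of_endAlgebra_of_forall_cmProdAV h hCM hend⟩

/-- **`HC_CM` ⟺ its binder-language slices at the Galois CM fields of degree `≥ 6`** — the per-field slice theorems of
the cell (degree `≤ 4`, cyclotomic, Galois sextic modulo Markman, …) are literally the `F`-components of `HC_CM`.  Neither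
side is asserted. [cite: Milne2020HodgeClassesAV, proof of Theorem 1] [cite: Shimura1998, §6.2 Theorem 3 and §8.2 Proposition 26] -/
theorem hc_cm_iff_forall_galois_binderSlice :
    HC_CM ↔ ∀ (F : Type) [Field F] [NumberField F] [IsCMField F], IsGalois ℚ F → 6 ≤ Module.finrank ℚ F →
      ∀ A : AbelianVariety ℂ, IsSmoothProjective A.dim A.X →
        (∃ S : Subalgebra ℚ A.endAlgebra,
          IsReduced ↥S ∧ (∀ x ∈ S, ∀ y ∈ S, x * y = y * x) ∧ Module.finrank ℚ ↥S = 2 * A.dim) →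
        (∀ (B : AbelianVariety ℂ) (f : B ⟶ A), IsClosedImmersion (AbelianVariety.Hom.toSchemeHom f) →
          AbelianVariety.IsSimple B → 0 < B.dim → Nonempty (B.endAlgebra →+* F)) →
        HodgeConjectureFor A.dim A.X := by
  rw [hc_cm_iff_forall_galois_cmProdAV cmAbelianVarietyRealised_holds]
  exact ⟨fun h F _ _ _ hG h6 => binderSlice_iff_forall_cmProdAV.2 (h F hG h6),
    fun h F _ _ _ hG h6 => binderSlice_iff_forall_cmProdAV.1 (h F hG h6)⟩

/-- **`HC_CM` ⟺ its binder-language slices at ALL CM fields.** [cite: Milne2020HodgeClassesAV, proof of Theorem 1] -/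
theorem hc_cm_iff_forall_binderSlice :
    HC_CM ↔ ∀ (F : Type) [Field F] [NumberField F] [IsCMField F],
      ∀ A : AbelianVariety ℂ, IsSmoothProjective A.dim A.X →
        (∃ S : Subalgebra ℚ A.endAlgebra,
          IsReduced ↥S ∧ (∀ x ∈ S, ∀ y ∈ S, x * y = y * x) ∧ Module.finrank ℚ ↥S = 2 * A.dim) →
        (∀ (B : AbelianVariety ℂ) (f : B ⟶ A), IsClosedImmersion (AbelianVariety.Hom.toSchemeHom f) →
          AbelianVariety.IsSimple B → 0 < B.dim → Nonempty (B.endAlgebra →+* F)) →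
        HodgeConjectureFor A.dim A.X := by
  rw [hc_cm_iff_forall_cmProdAV cmAbelianVarietyRealised_holds]
  exact ⟨fun h F _ _ _ => binderSlice_iff_forall_cmProdAV.2 (h F), fun h F _ _ _ => binderSlice_iff_forall_cmProdAV.1 (h F)⟩

/-- **The cofinal binder form**: for any CM field `F₀`, `HC_CM ⟺` the binder-language slices at the Galois CM fields
receiving `F₀`. [cite: Shimura1998, §6.2 Theorem 3 and §18.2 Lemma (ii)–(iii)] -/
theorem hc_cm_iff_forall_galois_binderSlice_over (F₀ : Type) [Field F₀] [NumberField F₀] [IsCMField F₀] :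
    HC_CM ↔ ∀ (F : Type) [Field F] [NumberField F] [IsCMField F], IsGalois ℚ F → Nonempty (F₀ →+* F) →
      ∀ A : AbelianVariety ℂ, IsSmoothProjective A.dim A.X →
        (∃ S : Subalgebra ℚ A.endAlgebra,
          IsReduced ↥S ∧ (∀ x ∈ S, ∀ y ∈ S, x * y = y * x) ∧ Module.finrank ℚ ↥S = 2 * A.dim) →
        (∀ (B : AbelianVariety ℂ) (f : B ⟶ A), IsClosedImmersion (AbelianVariety.Hom.toSchemeHom f) →
          AbelianVariety.IsSimple B → 0 < B.dim → Nonempty (B.endAlgebra →+* F)) →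
        HodgeConjectureFor A.dim A.X := by
  rw [hc_cm_iff_forall_galois_cmProdAV_over F₀ cmAbelianVarietyRealised_holds]
  exact ⟨fun h F _ _ _ hG h0 => binderSlice_iff_forall_cmProdAV.2 (h F hG h0),
    fun h F _ _ _ hG h0 => binderSlice_iff_forall_cmProdAV.1 (h F hG h0)⟩

end Summit.HodgeConjecture.CorCM.SliceExhaustion

end
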